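import Summits.QuantumFields.YangMills.Theorems.BalabanUVNodesK0AxTangentSocketOntoFlatLetters
import Summits.QuantumFields.YangMills.Theorems.BalabanUVNodesN07Prop4WOfRecordPerLattice
import HarnessLib

/-!
# NODE O · K0ᴬ — THE FLAT (R-a) ROAD WITH (R2) DISCHARGED PER LATTICE: at the scheme of record (`N = 2`, `U₀ = 1`, every letter constructed, ✓p827017) the ONE analytic input
# `QuadAnalytic W C₄ a₃` ([15] Prop. 4) is now SUPPLIED in the small by ✓`exists_quadAnalytic_WOfRecordAt_one` — the road displays ONLY N07's KNIT tokens for the in-the-small scheme,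
# «`0 < ε_C ≤ t₀`», the chart letter, (J-crit′)∕(J-cons′), and numerics

Cell `pub-ymgap`, width seat `pub-ymgap-dag-n07-w3` (g27), INTENT-19 ∕ CLAIM-19.  `--kind proof --supports stmt-QuantumFields-27238 --as helper`; count-neutral.
[15] = [Balaban1985Variational]; [B9] = [Balaban1985BackgroundPropagators].

WHAT.  ★★★★ `rootedReceipts_of_knitTokens_atScale_recordScheme` (general `G′`, its two rows displayed) and ★★★★ `rootedReceipts_of_knitTokens_atScale_recordScheme_printGreen` (print's
`G′ := (Δ_{U₀} + a′·proj_{N(Q′♭)ᗮ})⁻¹`, rows supplied): ✓`rootedReceipts_of_tokens_atScale_recordScheme_flatLetters{,_printGreen}` (✓p827017) with their hypothesis (R2)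
`QuadAnalytic (WOfRecordAt F 2 K (k+1) Ω 1 levB a hpos♭ hQ ε_C G′) C₄ a₃` DISCHARGED by ✓`N07Prop4WOfRecordPerLattice.exists_quadAnalytic_WOfRecordAt_one` (CLAIM-18: [15] Prop. 4 (98) per
lattice in the small — lit ✓`exists_quadAnalytic_W80` fed by the Sect. C regime in the small ✓p826188 and the V₀ slot ✓`Prop4V0AtRecord`).  The scheme's Prop.-4 data `C₄`, `a₃` and the
domain radius `t` become OUTPUTS (existential, with `0 ≤ C₄`, `0 < a₃ ≤ ε_C`, `0 < t`); the scheme is def-Y's `bgSchemeOfRecord F 2 K (k+1) Ω 1 {V | ‖𝔄 V‖ < t} levB G′ 0 a hposπ hpos♭ hQ ε_C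
‖𝔊(1)‖ C₄ a₃ 0 t t` VERBATIM (binders inhabited by name as in ✓p827017).
DISPLAY OF THE FLAT (R-a) ROAD AFTER THIS FILE: (i) N07's five KNIT tokens for that scheme `S` (`Kc` range ∕ covers ∕ `sol_of_isMinOn` ∕ `star_mem` ∕ `star_isMinOn` — [15] Prop. 7 ∕
Thm 1 content, n07 lanes), (ii) «`0 < ε_C ≤ t₀`» (a CHOICE), (iii) the chart letter `exp ρ₈ ⊆ SU(2)` (inhabited at the fill `thetaFill`), (iv) (J-crit′)∕(J-cons′) (DEF-1), (v) numerics
`0 < a`, `0 < a′`, `k + 2 ≤ m + K` (general `G′`: plus its two rows).  No (R2), no `RegimeTok`, no `Δ2` token, no positivity ∕ surjectivity binder, no `dom ∈ 𝓝 1`, no radius bookkeeping.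

HONEST LABELS.  By-name packaging of landed theorems; PER-LATTICE, IN-THE-SMALL, EXISTENTIAL constants (`t₀`, `C₄`, `a₃`, `t` depend on the lattice and the binders — NOT print's «d and
L only»); the KNIT tokens ([15] Prop. 7 ∕ Thm 1 at the record) and the dictionaries are NOT touched; K0ᴬ ⟨27238⟩ NOT closed; NODE O 0∕1; N07 NOT discharged; R4 is the conditional
finite-𝕋⁴ rung `BalabanLadder.UV` only; finite torus, fixed `ε` — nothing continuum ∕ OS ∕ Clay.  **The Yang–Mills mass gap is NOT proved by any of this.**  No `sorry`, no
`instance ∕ notation`; standard axioms.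
-/

set_option autoImplicit false

noncomputable section

open scoped BigOperators Matrix.Norms.L2Operator InnerProductSpace

namespace Summit.QuantumFields.YangMills.Theorems.K0AxTangentSocketOntoOfKnitTokens

open Literature.MathematicalPhysics.QuantumFieldTheory.Balaban1983to89
open Literature.MathematicalPhysics.QuantumFieldTheory.Balaban1983to89.T4Continuum (T4Family)
open Literature.MathematicalPhysics.QuantumFieldTheory.Balaban1983to89.Node00
open B12GaugeOrbits021 (OrbitRel)
open B11Prop6Scheme (mapT)
open B13Contraction113 (QuadAnalytic)
open B9Eq311TracePairing (starW)
open B11Eq103H1Complex (BondL2K SiteL2K covLaplaceSiteK greenK)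
open B15DeterminingSets (MSField avgFamily atScale)
open NormedSpace (exp)
open Summit.QuantumFields.YangMills.Theorems.K0RecordFormatNames
open Summit.QuantumFields.YangMills.Theorems.K0AxRootGrad
open Summit.QuantumFields.YangMills.Theorems.K0AxCtabUniq
open Summit.QuantumFields.YangMills.Theorems.N07TraceSectorDefs (scalPartW)
open Summit.QuantumFields.YangMills.Theorems.N07HessOpOfRecordPiFlat (laplaceAOfRecordAt128_one_zero_pos)
open Summit.QuantumFields.YangMills.Theorems.N07LaplaceAOfRecordFlatPos (laplaceAOfRecord_one_flat_pos)
open Summit.QuantumFields.YangMills.Theorems.N07QOfRecordFlatOnto (QOfRecord_one_surjective)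
open Summit.QuantumFields.YangMills.Theorems.N07PrintProjectionOfRecord (covLaplaceSiteOfRecord_add_kerProj_pos)
open Summit.QuantumFields.YangMills.Theorems.K0AxTangentSocketOntoFlatLetters (rootedReceipts_of_tokens_atScale_recordScheme_flatLetters
  rootedReceipts_of_tokens_atScale_recordScheme_flatLetters_printGreen)
open Summit.QuantumFields.YangMills.Theorems.N07Prop4WOfRecordPerLattice (exists_quadAnalytic_WOfRecordAt_one)

/-! ## §0  (R2) per lattice in the small with ONE threshold for every `G′` (any `N`, guarded `U₀`) -/

section Prop4W

open T4Continuum BlockAveraging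
open B11Eq111FrakG (nabla115)
open B11Eq115Space (NegSize)
open B11Ineq73KernelLettersPerLattice (exists_quadAnalytic_W80)
open Summit.QuantumFields.YangMills.Theorems.N07SectCRegimeOfRecordSmall (exists_sectCRegime_ofRecord)
open Summit.QuantumFields.YangMills.Theorems.N07Prop4WOfRecordPerLattice (curV0AtRecord_quadBound_perLattice quadAnalytic_of_radius_le)

variable (F : T4Family) (N : ℕ) [NeZero N] (K : ℕ) (k : ℕ) (Ω : ℕ → Set (Site (F.P K) 0)) (U₀ : GaugeField (F.P K) 0 (SU N))
  [Fact (0 < (F.L : ℝ))] [Fact (0 < (F.P K).eta k)] [Fact (0 < c0Rec F K k)] [Fact (∀ c, 0 < wBRec F K k c)]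
  (levB : PBond (F.P K) k → ℕ) (a : ℝ)
  (hposb : ∀ x, x ≠ 0 → 0 < RCLike.re ⟪x, laplaceAOfRecord F N k U₀ (QOfRecord F N k U₀) (QflatOfRecord F N k) a x⟫_ℂ)
  (hQ : Function.Surjective (QOfRecord F N k U₀))

/-- ★★★ **(R2) PER LATTICE IN THE SMALL, ONE THRESHOLD `t₀` FOR EVERY `G′`** (the threshold of ✓`exists_quadAnalytic_WOfRecordAt` is the Sect. C regime's, independent of the (3.119) letter `Δ_π(G′)`,
which lit ✓`exists_quadAnalytic_W80` accepts arbitrarily). [cite: Balaban1985Variational, Prop. 4 (97)–(98) pp.292–293, (73) p.289, (80) p.290] -/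
theorem exists_quadAnalytic_WOfRecordAt_forall (hU₀ : SmallBelow (avOfRecord F N K) k U₀) :
    ∃ t₀ > 0, ∀ (Gp : SiteL2K ℂ (F.P K).d (fun _ => (F.P K).sitesPerDir 0) (c0Rec F K k) (WRec N) →ₗ[ℂ]
        SiteL2K ℂ (F.P K).d (fun _ => (F.P K).sitesPerDir 0) (c0Rec F K k) (WRec N)) (εC : ℝ),
      0 < εC → εC ≤ t₀ → ∃ a₃ > 0, ∃ C₄ ≥ 0, a₃ ≤ εC ∧ QuadAnalytic (WOfRecordAt F N K k Ω U₀ levB a hposb hQ εC Gp) C₄ a₃ := by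
  haveI : CompleteSpace (NegSize (F.L : ℝ) ((F.P K).eta k) levB 0 (Matrix (Fin N) (Fin N) ℂ)) := FiniteDimensional.complete ℂ _
  obtain ⟨b, C₂, c₄, t₀, -, -, -, ht₀, hP, hRC⟩ := exists_sectCRegime_ofRecord F N K k Ω U₀ levB a hposb hQ hU₀
  obtain ⟨CV, hCV, hqV⟩ := curV0AtRecord_quadBound_perLattice F N K k Ω U₀
  refine ⟨t₀, ht₀, fun Gp εC hεC hεt => ?_⟩
  obtain ⟨R', hR', C₄, hC₄, hq, -⟩ := exists_quadAnalytic_W80 (rhoRec N) (tauRecCLM N) (unitsOfRecord F N U₀) hCV (by norm_num : (0 : ℝ) < 1 / 16) hqV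
    (hRC εC εC hεC le_rfl hεt) hP hεC (JOfRecordAtBg F N K k Ω U₀) (DeltaPiCurOfRecord F N K k Ω U₀ Gp (QflatOfRecord F N k))
  exact ⟨min R' εC, lt_min hR' hεC, C₄, hC₄, min_le_right _ _, quadAnalytic_of_radius_le hq (min_le_left _ _)⟩

end Prop4W

section Road

variable (F : T4Family) (θ : Stage13Params F 2) (k K : ℕ) [Fact (0 < (F.L : ℝ))] [Fact (0 < (F.P K).eta (k + 1))] [Fact (0 < c0Rec F K (k + 1))]
  [Fact (∀ c, 0 < wBRec F K (k + 1) c)]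
  (Ω : ℕ → Set (Site (F.P K) 0)) (levB : PBond (F.P K) (k + 1) → ℕ) {a : ℝ} (ha : 0 < a)

set_option maxHeartbeats 1600000 in
/-- ★★★★ **THE FLAT (R-a) ROAD MODULO THE KNIT TOKENS ONLY (general `G′`)**: for `0 < ε_C ≤ t₀` and the chart letter there are Prop.-4 data `C₄ ≥ 0`, `0 < a₃ ≤ ε_C` and a radius `t > 0` such
that at def-Y's scheme of record `S` (flat, every letter constructed, `Δ2 := 0`) N07's KNIT tokens and (J-crit′)∕(J-cons′) give K0ᴬ (R-a)'s four rooted receipts and `C²` chart entries.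
DISPLAYED besides: the two `G′` rows; numerics `0 < a`, `k + 2 ≤ m + K`.
[cite: Balaban1985Variational, Prop. 4 (98) p.293, Prop. 6 (115)–(121) p.295, Prop. 7 p.299, Thm 1 p.279, Prop. 9 p.309; Balaban1985BackgroundPropagators, Thm 3.11 p.416, Thm 3.12 p.421] -/
theorem rootedReceipts_of_knitTokens_atScale_recordScheme (hk2 : k + 2 ≤ (F.P K).m + (F.P K).K) :
    ∃ t₀ > 0, ∀ (Gp : SiteL2K ℂ (F.P K).d (fun _ => (F.P K).sitesPerDir 0) (c0Rec F K (k + 1)) (WRec 2) →ₗ[ℂ]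
        SiteL2K ℂ (F.P K).d (fun _ => (F.P K).sitesPerDir 0) (c0Rec F K (k + 1)) (WRec 2)) (εC : ℝ),
      0 < εC → εC ≤ t₀ →
      (∀ s, Gp (starW (phiRec 2) s) = starW (phiRec 2) (Gp s)) → (∀ s, Gp (scalPartW 2 _ s) = scalPartW 2 _ (Gp s)) →
      (letI := θ.instVβ₁; letI := θ.instVβ₂; ∀ v : θ.Vβ, NormedSpace.exp (θ.ρ8 v) ∈ Matrix.specialUnitaryGroup (Fin 2) ℂ) →
      ∃ C₄ a₃ t : ℝ, 0 ≤ C₄ ∧ 0 < a₃ ∧ a₃ ≤ εC ∧ 0 < t ∧ ∀ (S : BgSchemeOnLit F 2 K (k + 1) Ω 1),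
        S = bgSchemeOfRecord F 2 K (k + 1) Ω 1
            {V : GaugeField (F.P K) (k + 1) (SU 2) | ‖frakAOfRecordAtBg128 F 2 K (k + 1) Ω (1 : GaugeField (F.P K) 0 (SU 2)) levB Gp 0 a
              (laplaceAOfRecordAt128_one_zero_pos F 2 (k + 1) ha Gp) (QOfRecord_one_surjective F 2 K (k + 1) (le_trans (Nat.le_succ _) hk2)) V‖ < t}
            levB Gp 0 a (laplaceAOfRecordAt128_one_zero_pos F 2 (k + 1) ha Gp) (laplaceAOfRecord_one_flat_pos F 2 (k + 1) ha)
            (QOfRecord_one_surjective F 2 K (k + 1) (le_trans (Nat.le_succ _) hk2)) εC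
            ‖frakGOfRecordAtBg128 F 2 K (k + 1) Ω (1 : GaugeField (F.P K) 0 (SU 2)) Gp 0 a (laplaceAOfRecordAt128_one_zero_pos F 2 (k + 1) ha Gp)
              (QOfRecord_one_surjective F 2 K (k + 1) (le_trans (Nat.le_succ _) hk2))‖ C₄ a₃ 0 t t →
        ∀ (Kc : GaugeField (F.P K) (k + 1) (SU 2) → Set (Space115Lit F 2 K (k + 1) Ω 1)),
        (∀ V ∈ S.dom, ∀ A ∈ Kc V, S.chart V A ∈ bgReg F 2 K (k + 1) θ.εbg ∧ Averaging.iter (avOfRecord F 2 K) (k + 1) (S.chart V A) = V) →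
        (∀ V ∈ S.dom, ∀ U : GaugeField (F.P K) 0 (SU 2), U ∈ bgReg F 2 K (k + 1) θ.εbg →
          Averaging.iter (avOfRecord F 2 K) (k + 1) U = V → ∃ A ∈ Kc V, OrbitRel (k + 1) (S.chart V A) U) →
        (∀ V ∈ S.dom, ∀ A ∈ Kc V, IsMinOn (wilsonAction4 ∘ S.chart V) (Kc V) A → ‖A‖ ≤ S.ε₄ ∧ mapT (S.𝒢 V) 0 (S.W V) (S.J V) (S.𝔄 V) A = A) →
        (∀ V ∈ S.dom, S.sol V ∈ Kc V) → (∀ V ∈ S.dom, IsMinOn (wilsonAction4 ∘ S.chart V) (Kc V) (S.sol V)) →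
        FlatCritDictionary F k K (msChart F 2 K (k + 1) (atScale (k + 1)) (avgFamily (avOfRecord F 2 K) 1) (1 : GaugeField (F.P K) 0 (SU 2))) →
        FlatConsDictionary F θ k K (msChart F 2 K (k + 1) (atScale (k + 1)) (avgFamily (avOfRecord F 2 K) 1) (1 : GaugeField (F.P K) 0 (SU 2)))
          (fun B => msChart F 2 K (k + 1) (atScale (k + 1)) (avgFamily (avOfRecord F 2 K) 1) (1 : GaugeField (F.P K) 0 (SU 2)) (S.lieExpo (unitField F θ k K B))) →
        (∀ (a'' : θ.ιβ) (l : RespLabel F k K),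
          RootedResponseCriticalModGaugeAt F θ k K a'' l ∧ RootedResponseOrbitAt F θ k K a'' l ∧
            RootedResponseInvCriticalAt F θ k K a'' l ∧ RootedResponseConstraintModGaugeAt F θ k K a'' l) ∧
        letI := θ.instVβ₁; letI := θ.instVβ₂
        ContDiffAt ℝ 2 (fun B : Fin (F.P K).d → Site (F.P K) (k + 1) → θ.Vβ =>
          fun (b : PBond (F.P K) 0) (i i' : Fin 2) => ((recordBgField F θ k K B b : SU 2) : Matrix (Fin 2) (Fin 2) ℂ) i i') 0 := by
  obtain ⟨t₁, ht₁, hroad⟩ := rootedReceipts_of_tokens_atScale_recordScheme_flatLetters F θ k K Ω levB ha hk2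
  obtain ⟨t₂, ht₂, hR2⟩ := exists_quadAnalytic_WOfRecordAt_forall F 2 K (k + 1) Ω (1 : GaugeField (F.P K) 0 (SU 2)) levB a
    (laplaceAOfRecord_one_flat_pos F 2 (k + 1) ha) (QOfRecord_one_surjective F 2 K (k + 1) (le_trans (Nat.le_succ _) hk2))
    (Summit.QuantumFields.YangMills.BalabanUVNodes.N07ChartLineFactsS1.smallBelow_one F K (k + 1))
  refine ⟨min t₁ t₂, lt_min ht₁ ht₂, fun Gp εC hεC hεt hGpR hGpS hρ => ?_⟩
  obtain ⟨a₃, ha₃, C₄, hC₄, ha₃ε, hW⟩ := hR2 Gp εC hεC (hεt.trans (min_le_right _ _))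
  obtain ⟨t, ht, hS⟩ := hroad Gp εC C₄ a₃ hC₄ ha₃ ha₃ε (hεt.trans (min_le_left _ _)) hW hGpR hGpS hρ
  exact ⟨C₄, a₃, t, hC₄, ha₃, ha₃ε, ht, hS⟩

set_option maxHeartbeats 1600000 in
/-- ★★★★ **THE FLAT (R-a) ROAD MODULO THE KNIT TOKENS ONLY, PRINT's `G′`** (`G′ := (Δ_{U₀} + a′·proj_{N(Q′♭)ᗮ})⁻¹`, rows supplied, ✓p826780 ∕ ✓p827017): for `0 < ε_C ≤ t₀` and the chart letter
there are `C₄ ≥ 0`, `0 < a₃ ≤ ε_C`, `t > 0` such that at def-Y's flat scheme of record N07's KNIT tokens and (J-crit′)∕(J-cons′) give the four rooted receipts and the `C²` chart entries.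
DISPLAYED besides: numerics `0 < a`, `0 < a′`, `k + 2 ≤ m + K` — nothing else.
[cite: Balaban1985Variational, Prop. 4 (98) p.293, Prop. 6 (115)–(121) p.295, Prop. 7 p.299, Thm 1 p.279, Prop. 9 p.309; Balaban1985BackgroundPropagators, (3.24)–(3.25) p.394, Thm 3.11 p.416, Thm 3.12 p.421] -/
theorem rootedReceipts_of_knitTokens_atScale_recordScheme_printGreen {a' : ℝ} (ha' : 0 < a') (hk2 : k + 2 ≤ (F.P K).m + (F.P K).K) :
    haveI : (LinearMap.ker (QflatOfRecord F 2 (K := K) (k + 1))).HasOrthogonalProjection :=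
      haveI : CompleteSpace ↥(LinearMap.ker (QflatOfRecord F 2 (K := K) (k + 1))) := FiniteDimensional.complete ℂ _
      inferInstance
    ∃ t₀ > 0, ∀ (εC : ℝ), 0 < εC → εC ≤ t₀ →
      (letI := θ.instVβ₁; letI := θ.instVβ₂; ∀ v : θ.Vβ, NormedSpace.exp (θ.ρ8 v) ∈ Matrix.specialUnitaryGroup (Fin 2) ℂ) →
      ∃ C₄ a₃ t : ℝ, 0 ≤ C₄ ∧ 0 < a₃ ∧ a₃ ≤ εC ∧ 0 < t ∧ ∀ (S : BgSchemeOnLit F 2 K (k + 1) Ω 1),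
        S = bgSchemeOfRecord F 2 K (k + 1) Ω 1
            {V : GaugeField (F.P K) (k + 1) (SU 2) | ‖frakAOfRecordAtBg128 F 2 K (k + 1) Ω (1 : GaugeField (F.P K) 0 (SU 2)) levB
              (greenK _ (covLaplaceSiteOfRecord_add_kerProj_pos F 2 (k + 1) (1 : GaugeField (F.P K) 0 (SU 2)) ha')) 0 a
              (laplaceAOfRecordAt128_one_zero_pos F 2 (k + 1) ha _) (QOfRecord_one_surjective F 2 K (k + 1) (le_trans (Nat.le_succ _) hk2)) V‖ < t}
            levB (greenK _ (covLaplaceSiteOfRecord_add_kerProj_pos F 2 (k + 1) (1 : GaugeField (F.P K) 0 (SU 2)) ha')) 0 a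
            (laplaceAOfRecordAt128_one_zero_pos F 2 (k + 1) ha _) (laplaceAOfRecord_one_flat_pos F 2 (k + 1) ha)
            (QOfRecord_one_surjective F 2 K (k + 1) (le_trans (Nat.le_succ _) hk2)) εC
            ‖frakGOfRecordAtBg128 F 2 K (k + 1) Ω (1 : GaugeField (F.P K) 0 (SU 2))
              (greenK _ (covLaplaceSiteOfRecord_add_kerProj_pos F 2 (k + 1) (1 : GaugeField (F.P K) 0 (SU 2)) ha')) 0 a
              (laplaceAOfRecordAt128_one_zero_pos F 2 (k + 1) ha _) (QOfRecord_one_surjective F 2 K (k + 1) (le_trans (Nat.le_succ _) hk2))‖ C₄ a₃ 0 t t →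
        ∀ (Kc : GaugeField (F.P K) (k + 1) (SU 2) → Set (Space115Lit F 2 K (k + 1) Ω 1)),
        (∀ V ∈ S.dom, ∀ A ∈ Kc V, S.chart V A ∈ bgReg F 2 K (k + 1) θ.εbg ∧ Averaging.iter (avOfRecord F 2 K) (k + 1) (S.chart V A) = V) →
        (∀ V ∈ S.dom, ∀ U : GaugeField (F.P K) 0 (SU 2), U ∈ bgReg F 2 K (k + 1) θ.εbg →
          Averaging.iter (avOfRecord F 2 K) (k + 1) U = V → ∃ A ∈ Kc V, OrbitRel (k + 1) (S.chart V A) U) →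
        (∀ V ∈ S.dom, ∀ A ∈ Kc V, IsMinOn (wilsonAction4 ∘ S.chart V) (Kc V) A → ‖A‖ ≤ S.ε₄ ∧ mapT (S.𝒢 V) 0 (S.W V) (S.J V) (S.𝔄 V) A = A) →
        (∀ V ∈ S.dom, S.sol V ∈ Kc V) → (∀ V ∈ S.dom, IsMinOn (wilsonAction4 ∘ S.chart V) (Kc V) (S.sol V)) →
        FlatCritDictionary F k K (msChart F 2 K (k + 1) (atScale (k + 1)) (avgFamily (avOfRecord F 2 K) 1) (1 : GaugeField (F.P K) 0 (SU 2))) →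
        FlatConsDictionary F θ k K (msChart F 2 K (k + 1) (atScale (k + 1)) (avgFamily (avOfRecord F 2 K) 1) (1 : GaugeField (F.P K) 0 (SU 2)))
          (fun B => msChart F 2 K (k + 1) (atScale (k + 1)) (avgFamily (avOfRecord F 2 K) 1) (1 : GaugeField (F.P K) 0 (SU 2)) (S.lieExpo (unitField F θ k K B))) →
        (∀ (a'' : θ.ιβ) (l : RespLabel F k K),
          RootedResponseCriticalModGaugeAt F θ k K a'' l ∧ RootedResponseOrbitAt F θ k K a'' l ∧
            RootedResponseInvCriticalAt F θ k K a'' l ∧ RootedResponseConstraintModGaugeAt F θ k K a'' l) ∧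
        letI := θ.instVβ₁; letI := θ.instVβ₂
        ContDiffAt ℝ 2 (fun B : Fin (F.P K).d → Site (F.P K) (k + 1) → θ.Vβ =>
          fun (b : PBond (F.P K) 0) (i i' : Fin 2) => ((recordBgField F θ k K B b : SU 2) : Matrix (Fin 2) (Fin 2) ℂ) i i') 0 := by
  haveI : (LinearMap.ker (QflatOfRecord F 2 (K := K) (k + 1))).HasOrthogonalProjection :=
    haveI : CompleteSpace ↥(LinearMap.ker (QflatOfRecord F 2 (K := K) (k + 1))) := FiniteDimensional.complete ℂ _
    inferInstance
  have hpos' := covLaplaceSiteOfRecord_add_kerProj_pos F 2 (k + 1) (1 : GaugeField (F.P K) 0 (SU 2)) ha'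
  obtain ⟨t₁, ht₁, hroad⟩ := rootedReceipts_of_tokens_atScale_recordScheme_flatLetters_printGreen F θ k K Ω levB ha ha' hk2
  obtain ⟨t₂, ht₂, hR2⟩ := exists_quadAnalytic_WOfRecordAt_forall F 2 K (k + 1) Ω (1 : GaugeField (F.P K) 0 (SU 2)) levB a
    (laplaceAOfRecord_one_flat_pos F 2 (k + 1) ha) (QOfRecord_one_surjective F 2 K (k + 1) (le_trans (Nat.le_succ _) hk2))
    (Summit.QuantumFields.YangMills.BalabanUVNodes.N07ChartLineFactsS1.smallBelow_one F K (k + 1))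
  refine ⟨min t₁ t₂, lt_min ht₁ ht₂, fun εC hεC hεt hρ => ?_⟩
  obtain ⟨a₃, ha₃, C₄, hC₄, ha₃ε, hW⟩ := hR2 (greenK _ hpos') εC hεC (hεt.trans (min_le_right _ _))
  obtain ⟨t, ht, hS⟩ := hroad εC C₄ a₃ hC₄ ha₃ ha₃ε (hεt.trans (min_le_left _ _)) hW hρ
  exact ⟨C₄, a₃, t, hC₄, ha₃, ha₃ε, ht, hS⟩

end Road

end Summit.QuantumFields.YangMills.Theorems.K0AxTangentSocketOntoOfKnitTokens

end
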